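import Mathlib
import Literature.Analysis.FluidPDE.CheskidovFriedlander2009.SteadyStateZerothLaw
import HarnessLib

/-!
# Cheskidov–Friedlander 2009, §2 for EVERY intermittency exponent: zig-zag instability replaces
# monotonicity — uniform floor/ceiling of the steady state and the limit `A_j → 1` (Lemma 2.3)
# for all ratios `r = 2^{2(1−c/3)} ≥ 1`, in particular at Kolmogorov scaling `c = 1`

A. Cheskidov, S. Friedlander, *The vanishing viscosity limit for a dyadic model*, Physica D 238
(2009) 783–787 = arXiv:0810.3718v1.  The printed steady-state theory (§2) rests on Thm. 2.2
(monotonicity `A_{j+1} < A_j`), which is proved only for `3/2 < c ≤ 5/2` (`1 < r < 2`): p. 4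
"This property is proved for `3/2 < c ≤ 5/2`. Hence the rest of the results in this paper are
valid only for this range", and §5 p. 8 "However for technical reasons we require `c > 3/2` in
order to prove monotonicity", while "the appropriate range for `c` … is `c ∈ [1, 5/2]`" and `c = 1`
is Kolmogorov's scaling.  (Numerically, monotonicity in fact FAILS at `c = 1` for small `μ`.)

This file removes the restriction for the steady states (`IsSteadyState μ r A` of
`SteadyState.lean`: positive bounded solutions of (2.1), `A_0A_1 + μA_0 = 1`,
`A_j² − A_{j+1}A_{j+2} = μr^{j+1}A_{j+1}`), for every `r ≥ 1` and without any monotonicity, by a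
ZIG-ZAG INSTABILITY argument: the inviscid recursion `A_{j+2} = A_j²/A_{j+1}` squares every ratio
deviation with alternating sign, and the viscous correction only helps the downward steps, so

* `IsSteadyState.sq_lt_mul` (no collapse): at every shell `A_m² < A_{m+1}(4r²A_m + μr^{m+1})` —
  were `A_{m+1} ≤ A_m/(4r² + μr^{m+1}/A_m)`, the even subsequence `A_{m+2k} ≥ A_m(4r²)^k` would be
  unbounded (`collapse_growth`, the printed alternating-increment induction of Thm. 2.2 run on
  RATIOS instead of increments, which is what frees it from `r < 2`);
* `IsSteadyState.inv_lt_sq`, `IsSteadyState.sq_lt`: the UNIFORM PINCHING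
  `1/(8r) < A_0² < 5r²` for every `0 < μ ≤ 1 ≤ r` (floor) resp. every `0 < μ`, `1 ≤ r` (ceiling),
  and `IsSteadyState.sq_lt_all`: `A_j² < 5r²` for ALL `j` (via the decreasing flux
  `A_j²A_{j+1} ≤ A_0²A_1 < A_0`, `flux_lt`);
* `IsSteadyState.amplify`, `amplify_iter`, `lt_of_up`, `lt_of_down`: an up-deviation
  `A_{j+1} ≥ (1+η)A_j` inside the inertial range TRIPLES every two shells
  (`A_{j+3} ≥ (1+3η)A_{j+2}`, tops non-decreasing) until it exceeds `2r`, where the next downward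
  step is a collapse — hence ratio pinching `A_{j+1} < (1+η)A_j`, `A_j < (1+η)A_{j+1}` whenever
  `μr^{j+2k+3} ≤ (η/2)A_{j+1}` with `3^kη ≥ 2r`;
* `IsSteadyState.abs_A_zero_sub_one_lt` (**Lemma 2.3 at `j = 0` for every `r ≥ 1`**): for every
  `δ > 0` there is `μ₁(r,δ) > 0` with `|A_0 − 1| < δ` for EVERY steady state with `0 < μ ≤ μ₁`;
  with the energy identity `μΣ_j r^jA_j² = A_0` (`hasSum_dissipation'`, here for all `r > 1`) this
  is the exact vanishing-viscosity limit of the steady dissipation, `→ ε_d`, and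
  `IsSteadyState.dissipation_floor`: `1/(8r) < μΣ_j r^jA_j²` for all `0 < μ ≤ 1 < r` — the
  steady-state zeroth law of the dyadic model at EVERY `0 < c < 3`, Kolmogorov's `c = 1`
  (`r = 2^{4/3}`) included.

The original-variables packaging (fixed force `f₀e₀`, all `ν > 0`, `0 < c < 3`) is
`steadyState_zerothLaw_of_lt_three` at the end, in the shape of `steadyState_zerothLaw`
(`SteadyStateZerothLaw.lean`, which needs `3/2 < c`).  No new definitions, no new facts.

## References
* [CheskidovFriedlander2009] Physica D 238 (2009) 783–787 = arXiv:0810.3718v1: §2 (2.1)–(2.3)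
  p. 4, Thm. 2.2 p. 4–5, Lemma 2.3 p. 5, Thm. 4.2 pp. 9–10, §5 p. 8 (the range of `c`).
-/

noncomputable section

open Filter Finset Set MeasureTheory
open scoped Topology BigOperators ENNReal

namespace Literature.Analysis.FluidPDE.CheskidovFriedlander2009

namespace IsSteadyState

variable {μ r : ℝ} {A : ℕ → ℝ}

/-! ### The two one-sided consequences of the recursion -/

/-- Upper recursion bound `A_{m+1}A_{m+2} ≤ A_m²` (the viscous term is non-negative).
[cite: CheskidovFriedlander2009, §2 (2.3) p.5] -/
theorem mul_le_sq (h : IsSteadyState μ r A) (hμ : 0 ≤ μ) (hr : 0 ≤ r) (m : ℕ) :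
    A (m + 1) * A (m + 2) ≤ A m ^ 2 := by
  have he := h.eq_succ m
  have h1 := h.pos (m + 1)
  have : 0 ≤ μ * r ^ (m + 1) * A (m + 1) := by positivity
  linarith

/-! ### No collapse: the zig-zag blow-up -/

/-- **Zig-zag growth after a collapse.** If at shell `m` the next amplitude has collapsed,
`A_{m+1}(4r²A_m + μr^{m+1}) ≤ A_m²`, then `A_{m+2k} ≥ A_m(4r²)^k` and `A_{m+2k+1} ≤ A_{m+1}` for
all `k` (`μ ≥ 0`, `r ≥ 1`): the lower recursion bound `A_{j+2} ≥ A_j²/A_{j+1} − μr^{j+1}` on the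
even steps, the upper one on the odd steps; the viscous loss `μr^{m+2k+1} ≤ μr^{m+1}(4r²)^k` is
absorbed by the hypothesis. (The printed Thm. 2.2 runs the same alternating induction on the
increments `h_j = A_j − A_{j−1}`, which needs `r < 2`; on ratios it needs nothing.)
[cite: CheskidovFriedlander2009, Thm 2.2 p.4–5 (proof)] -/
theorem collapse_growth (h : IsSteadyState μ r A) (hμ : 0 ≤ μ) (hr : 1 ≤ r) {m : ℕ}
    (hc : A (m + 1) * (4 * r ^ 2 * A m + μ * r ^ (m + 1)) ≤ A m ^ 2) (k : ℕ) :
    A m * (4 * r ^ 2) ^ k ≤ A (m + 2 * k) ∧ A (m + 2 * k + 1) ≤ A (m + 1) := by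
  have hr0 : 0 ≤ r := by linarith
  have hT := h.pos m
  have hB := h.pos (m + 1)
  have hb1 : (1 : ℝ) ≤ 4 * r ^ 2 := by nlinarith
  have hν0 : 0 ≤ μ * r ^ (m + 1) := by positivity
  -- `A_{m+1} ≤ A_m` (indeed `≤ A_m/(4r²)`)
  have hBT : A (m + 1) * (4 * r ^ 2) ≤ A m := by
    have h1 : A (m + 1) * (4 * r ^ 2 * A m) ≤ A m ^ 2 := by nlinarith
    have h2 : A (m + 1) * (4 * r ^ 2) * A m ≤ A m * A m := by nlinarith
    exact le_of_mul_le_mul_right h2 hT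
  have hBT' : A (m + 1) ≤ A m := by nlinarith
  induction k with
  | zero => exact ⟨by simp, by simp⟩
  | succ k ih =>
    obtain ⟨hX, hY⟩ := ih
    set X := A (m + 2 * k) with hXdef
    set Y := A (m + 2 * k + 1) with hYdef
    have hXpos : 0 < X := h.pos _
    have hYpos : 0 < Y := h.pos _
    have hZpos : 0 < A (m + 2 * k + 2) := h.pos _
    have hbk : (1 : ℝ) ≤ (4 * r ^ 2) ^ k := one_le_pow₀ hb1
    have hbk0 : (0 : ℝ) < (4 * r ^ 2) ^ k := by positivity
    -- the equation at shell `m + 2k`: `X² − Y·A_{m+2k+2} = μ r^{m+2k+1} Y`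
    have heq : X ^ 2 - Y * A (m + 2 * k + 2) = μ * r ^ (m + 2 * k + 1) * Y := by
      have := h.eq_succ (m + 2 * k)
      simpa [hXdef, hYdef, add_assoc] using this
    -- viscous loss: `μ r^{m+2k+1} ≤ μ r^{m+1} (4r²)^k`
    have hvisc : μ * r ^ (m + 2 * k + 1) ≤ μ * r ^ (m + 1) * (4 * r ^ 2) ^ k := by
      have hr2 : r ^ (2 * k) ≤ (4 * r ^ 2) ^ k := by
        rw [pow_mul]
        exact pow_le_pow_left₀ (sq_nonneg r) (by nlinarith) k
      calc μ * r ^ (m + 2 * k + 1) = μ * r ^ (m + 1) * r ^ (2 * k) := by ring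
        _ ≤ μ * r ^ (m + 1) * (4 * r ^ 2) ^ k := by gcongr
    -- lower step: `A_{m+2k+2} ≥ A_m (4r²)^{k+1}`
    have hkey : Y * (A m * (4 * r ^ 2) ^ (k + 1) + μ * r ^ (m + 2 * k + 1)) ≤ X ^ 2 := by
      have h1 : Y * (A m * (4 * r ^ 2) ^ (k + 1) + μ * r ^ (m + 2 * k + 1)) ≤
          A (m + 1) * ((4 * r ^ 2) ^ k * (4 * r ^ 2 * A m + μ * r ^ (m + 1))) := by
        have : A m * (4 * r ^ 2) ^ (k + 1) + μ * r ^ (m + 2 * k + 1) ≤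
            (4 * r ^ 2) ^ k * (4 * r ^ 2 * A m + μ * r ^ (m + 1)) := by
          rw [pow_succ]; nlinarith
        calc Y * (A m * (4 * r ^ 2) ^ (k + 1) + μ * r ^ (m + 2 * k + 1))
            ≤ Y * ((4 * r ^ 2) ^ k * (4 * r ^ 2 * A m + μ * r ^ (m + 1))) := by gcongr
          _ ≤ A (m + 1) * ((4 * r ^ 2) ^ k * (4 * r ^ 2 * A m + μ * r ^ (m + 1))) := by
              gcongr
      have h2 : A (m + 1) * ((4 * r ^ 2) ^ k * (4 * r ^ 2 * A m + μ * r ^ (m + 1))) ≤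
          (4 * r ^ 2) ^ k * A m ^ 2 := by nlinarith
      have h3 : (4 * r ^ 2) ^ k * A m ^ 2 ≤ X ^ 2 := by
        have h4 : (A m * (4 * r ^ 2) ^ k) ^ 2 ≤ X ^ 2 := pow_le_pow_left₀ (by positivity) hX 2
        have h5 : (4 * r ^ 2) ^ k * A m ^ 2 ≤ (A m * (4 * r ^ 2) ^ k) ^ 2 := by
          have : (A m * (4 * r ^ 2) ^ k) ^ 2 = (4 * r ^ 2) ^ k * A m ^ 2 * (4 * r ^ 2) ^ k := by
            ring
          rw [this]
          exact le_mul_of_one_le_right (by positivity) hbk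
        exact h5.trans h4
      exact h1.trans (h2.trans h3)
    have hZ : A m * (4 * r ^ 2) ^ (k + 1) ≤ A (m + 2 * k + 2) := by
      have : Y * (A m * (4 * r ^ 2) ^ (k + 1)) ≤ Y * A (m + 2 * k + 2) := by nlinarith
      exact le_of_mul_le_mul_left this hYpos
    -- upper step: `A_{m+2k+3} ≤ A_{m+1}`
    have hW : A (m + 2 * k + 3) ≤ A (m + 1) := by
      have hu := h.mul_le_sq hμ hr0 (m + 2 * k + 1)
      have hu' : A (m + 2 * k + 2) * A (m + 2 * k + 3) ≤ Y ^ 2 := by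
        simpa [hYdef, add_assoc] using hu
      have hbk1 : (1 : ℝ) ≤ (4 * r ^ 2) ^ (k + 1) := one_le_pow₀ hb1
      have hBZ : A (m + 1) ≤ A (m + 2 * k + 2) := by
        calc A (m + 1) ≤ A m := hBT'
          _ ≤ A m * (4 * r ^ 2) ^ (k + 1) := le_mul_of_one_le_right hT.le hbk1
          _ ≤ A (m + 2 * k + 2) := hZ
      have : A (m + 2 * k + 2) * A (m + 2 * k + 3) ≤ A (m + 2 * k + 2) * A (m + 1) := by
        nlinarith [mul_nonneg hB.le (sub_nonneg.2 hY)]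
      exact le_of_mul_le_mul_left this hZpos
    refine ⟨?_, ?_⟩
    · simpa [show m + 2 * (k + 1) = m + 2 * k + 2 by ring] using hZ
    · simpa [show m + 2 * (k + 1) + 1 = m + 2 * k + 3 by ring] using hW

/-- **No collapse.** For `μ ≥ 0`, `r ≥ 1`, at every shell `A_m² < A_{m+1}(4r²A_m + μr^{m+1})`,
i.e. `A_{m+1}/A_m > 1/(4r² + μr^{m+1}/A_m)`: a collapsed step would start an unbounded zig-zag
(`collapse_growth`). [cite: CheskidovFriedlander2009, Thm 2.2 p.4–5 (proof)] -/
theorem sq_lt_mul (h : IsSteadyState μ r A) (hμ : 0 ≤ μ) (hr : 1 ≤ r) (m : ℕ) :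
    A m ^ 2 < A (m + 1) * (4 * r ^ 2 * A m + μ * r ^ (m + 1)) := by
  by_contra hc
  push Not at hc
  obtain ⟨M, hM⟩ := h.bddAbove
  have hT := h.pos m
  have hb : (1 : ℝ) < 4 * r ^ 2 := by nlinarith
  obtain ⟨k, hk⟩ := pow_unbounded_of_one_lt (M / A m) hb
  have h1 := (h.collapse_growth hμ hr hc k).1
  have h2 := hM (m + 2 * k)
  rw [div_lt_iff₀ hT] at hk
  nlinarith

/-! ### The uniform pinching of the forced amplitude -/

/-- **Floor, uniform in the viscosity, every ratio `r ≥ 1`:** `A_0² > 1/(8r)` for `0 < μ ≤ 1`.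
Were `A_0 = a` that small, `A_1 = 1/a − μ ≥ 1/(2a)` is large and `A_2 ≤ a²/A_1` has collapsed
(`sq_lt_mul` at `m = 1` fails). At `r < 2` the printed argument gives `A_0 > 1/2` (`half_lt`).
[cite: CheskidovFriedlander2009, Lemma 2.3 p.5 and Thm 4.2 p.9–10] -/
theorem inv_lt_sq (h : IsSteadyState μ r A) (hμ : 0 < μ) (hμ1 : μ ≤ 1) (hr : 1 ≤ r) :
    1 / (8 * r) < A 0 ^ 2 := by
  by_contra hc
  push Not at hc
  have hr0 : 0 < r := by linarith
  have ha := h.pos 0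
  have hB := h.pos 1
  have h2 := h.pos 2
  have he0 := h.eq_zero
  -- `a² ≤ 1/8`, `a ≤ 1/2`, `64 a⁴ r² ≤ 1`
  have ha8 : A 0 ^ 2 * (8 * r) ≤ 1 := by rwa [le_div_iff₀ (by positivity)] at hc
  have ha2 : A 0 ^ 2 ≤ 1 / 8 := by nlinarith
  have ha12 : A 0 ≤ 1 / 2 := by nlinarith
  have ha4 : 64 * (A 0 ^ 2) ^ 2 * r ^ 2 ≤ 1 := by
    have hx : 0 ≤ A 0 ^ 2 * (8 * r) := by positivity
    have : 64 * (A 0 ^ 2) ^ 2 * r ^ 2 = (A 0 ^ 2 * (8 * r)) ^ 2 := by ring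
    rw [this]
    exact pow_le_one₀ hx ha8
  -- `a A_1 = 1 − μ a ≥ 1/2`, so `A_1 ≥ 1`
  have haB : 1 / 2 ≤ A 0 * A 1 := by nlinarith
  have hB1 : 1 ≤ A 1 := by nlinarith
  -- the collapse at `m = 1`: `A_1³ < A_1A_2(4r²A_1 + μr²) ≤ a²(4r²A_1 + r²) ≤ 5a²r²A_1`
  have hnc := h.sq_lt_mul hμ.le hr 1
  have hu := h.mul_le_sq hμ.le hr0.le 0
  norm_num at hnc hu
  have h3 : A 1 ^ 3 < A 0 ^ 2 * (4 * r ^ 2 * A 1 + μ * r ^ 2) := by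
    have : A 1 ^ 3 < A 1 * A 2 * (4 * r ^ 2 * A 1 + μ * r ^ 2) := by nlinarith
    have h4 : A 1 * A 2 * (4 * r ^ 2 * A 1 + μ * r ^ 2) ≤
        A 0 ^ 2 * (4 * r ^ 2 * A 1 + μ * r ^ 2) := by
      have : 0 ≤ 4 * r ^ 2 * A 1 + μ * r ^ 2 := by positivity
      exact mul_le_mul_of_nonneg_right hu this
    linarith
  have h5 : A 1 ^ 3 < 5 * A 0 ^ 2 * r ^ 2 * A 1 := by
    have : μ * r ^ 2 ≤ r ^ 2 * A 1 := by nlinarith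
    nlinarith
  have h6 : A 1 ^ 2 < 5 * A 0 ^ 2 * r ^ 2 := by
    have : A 1 * A 1 ^ 2 < A 1 * (5 * A 0 ^ 2 * r ^ 2) := by nlinarith
    exact lt_of_mul_lt_mul_left this hB.le
  -- but `a²A_1² ≥ 1/4 > 5/64 ≥ 5a⁴r²`
  nlinarith

/-- **Ceiling, every viscosity, every ratio `r ≥ 1`:** `A_0² < 5r²` for `0 < μ`. Were `A_0 = a`
that large, `A_1 < 1/a` has collapsed (`sq_lt_mul` at `m = 0` fails, using `μa < 1`). At `r < 2`
the printed bound is `A_0 < 4/3`. [cite: CheskidovFriedlander2009, Lemma 2.3 p.5] -/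
theorem sq_lt (h : IsSteadyState μ r A) (hμ : 0 < μ) (hr : 1 ≤ r) : A 0 ^ 2 < 5 * r ^ 2 := by
  by_contra hc
  push Not at hc
  have ha := h.pos 0
  have hB := h.pos 1
  have he0 := h.eq_zero
  have hμa := h.mu_mul_A_zero_lt_one
  have hnc := h.sq_lt_mul hμ.le hr 0
  norm_num at hnc
  -- `a³ < aA_1(4r²a + μr) < 4r²a + μr`, `μ a r < r`, `a² ≥ 5`, `r ≤ r²`
  have ha1 : 1 ≤ A 0 ^ 2 := by nlinarith
  have h1 : A 0 * A 1 < 1 := by nlinarith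
  have h2 : A 0 ^ 3 < 4 * r ^ 2 * A 0 + μ * r := by
    have hpos : 0 < 4 * r ^ 2 * A 0 + μ * r := by positivity
    have : A 0 ^ 3 < A 0 * A 1 * (4 * r ^ 2 * A 0 + μ * r) := by nlinarith
    nlinarith
  have h3 : A 0 ^ 4 < 4 * r ^ 2 * A 0 ^ 2 + r := by
    have : μ * r * A 0 < r := by nlinarith
    nlinarith
  nlinarith

/-- Hence `A_0 < 3r`. [cite: CheskidovFriedlander2009, Lemma 2.3 p.5] -/
theorem lt_three_mul (h : IsSteadyState μ r A) (hμ : 0 < μ) (hr : 1 ≤ r) : A 0 < 3 * r := by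
  have := h.sq_lt hμ hr
  have ha := h.pos 0
  nlinarith

/-- Hence `A_0 > 1/(8r)` (`0 < μ ≤ 1 ≤ r`). [cite: CheskidovFriedlander2009, Thm 4.2 p.9–10] -/
theorem inv_lt (h : IsSteadyState μ r A) (hμ : 0 < μ) (hμ1 : μ ≤ 1) (hr : 1 ≤ r) :
    1 / (8 * r) < A 0 := by
  have h1 := h.inv_lt_sq hμ hμ1 hr
  have ha := h.pos 0
  have hr0 : 0 < r := by linarith
  have h8 : 1 / (8 * r) ≤ 1 := by
    rw [div_le_iff₀ (by positivity)]; linarith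
  by_cases ha1 : A 0 ≤ 1
  · have : A 0 ^ 2 ≤ A 0 := by nlinarith
    linarith
  · push Not at ha1
    linarith

/-! ### The flux and a uniform bound on all amplitudes -/

/-- The flux `Π_j = A_j²A_{j+1}` is non-increasing: `A_{j+1}²A_{j+2} ≤ A_j²A_{j+1}`
(`Π_j − Π_{j+1} = μr^{j+1}A_{j+1}² ≥ 0`). [cite: CheskidovFriedlander2009, Lemma 2.1 p.4 (proof)] -/
theorem flux_succ_le (h : IsSteadyState μ r A) (hμ : 0 ≤ μ) (hr : 0 ≤ r) (j : ℕ) :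
    A (j + 1) ^ 2 * A (j + 2) ≤ A j ^ 2 * A (j + 1) := by
  have he := h.eq_succ j
  have h1 := h.pos (j + 1)
  have : 0 ≤ μ * r ^ (j + 1) * A (j + 1) * A (j + 1) := by positivity
  nlinarith

/-- `A_j²A_{j+1} ≤ A_0²A_1 < A_0` for all `j` (`A_0²A_1 = A_0(1 − μA_0)`).
[cite: CheskidovFriedlander2009, Lemma 2.1 p.4 (proof)] -/
theorem flux_lt (h : IsSteadyState μ r A) (hμ : 0 < μ) (hr : 0 ≤ r) (j : ℕ) :
    A j ^ 2 * A (j + 1) < A 0 := by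
  have hle : A j ^ 2 * A (j + 1) ≤ A 0 ^ 2 * A 1 := by
    induction j with
    | zero => exact le_rfl
    | succ j ih => exact (h.flux_succ_le hμ.le hr j).trans ih
  have ha := h.pos 0
  have he0 := h.eq_zero
  have : A 0 ^ 2 * A 1 < A 0 := by nlinarith [mul_pos hμ ha]
  linarith

/-- **Uniform bound on every amplitude:** `A_j² < 5r²` for all `j`, every `μ > 0`, `r ≥ 1` — so
`A_j < √5·r` uniformly in the viscosity (at `r < 2` the printed bound is `A_j ≤ A_0 < 4/3`). In the
inertial range a large `A_{j+1}` forces a collapsed `A_{j+2} < A_0/A_{j+1}²` (flux), excluded by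
`sq_lt_mul`; in the dissipation range `A_{j+1} < μr^{j+2}` directly.
[cite: CheskidovFriedlander2009, Lemma 2.1 p.4 and Thm 2.2 p.4] -/
theorem sq_lt_all (h : IsSteadyState μ r A) (hμ : 0 < μ) (hr : 1 ≤ r) (j : ℕ) :
    A j ^ 2 < 5 * r ^ 2 := by
  have hr0 : 0 ≤ r := by linarith
  cases j with
  | zero => exact h.sq_lt hμ hr
  | succ j =>
    by_contra hc
    push Not at hc
    have h0 := h.sq_lt hμ hr
    have ha := h.pos 0
    have hX := h.pos (j + 1)
    have hZ := h.pos (j + 2)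
    -- `A_0 < A_{j+1}`
    have h0X : A 0 < A (j + 1) := by nlinarith
    have hfl := h.flux_lt hμ hr0 (j + 1)
    by_cases hcase : μ * r ^ (j + 2) ≤ A (j + 1)
    · -- inertial shell: no collapse at `m = j+1`
      have hnc := h.sq_lt_mul hμ.le hr (j + 1)
      have h1 : A (j + 1) ^ 2 < A (j + 1 + 1) * (5 * r ^ 2 * A (j + 1)) := by
        have : 4 * r ^ 2 * A (j + 1) + μ * r ^ (j + 1 + 1) ≤ 5 * r ^ 2 * A (j + 1) := by
          have : μ * r ^ (j + 1 + 1) ≤ r ^ 2 * A (j + 1) := by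
            rw [show j + 1 + 1 = j + 2 from rfl]
            calc μ * r ^ (j + 2) ≤ A (j + 1) := hcase
              _ ≤ r ^ 2 * A (j + 1) := le_mul_of_one_le_left hX.le (by nlinarith)
          linarith
        calc A (j + 1) ^ 2 < A (j + 1 + 1) * (4 * r ^ 2 * A (j + 1) + μ * r ^ (j + 1 + 1)) := hnc
          _ ≤ A (j + 1 + 1) * (5 * r ^ 2 * A (j + 1)) := by gcongr
      have h2 : A (j + 1) < 5 * r ^ 2 * A (j + 2) := by
        have : A (j + 1) * A (j + 1) < A (j + 1) * (5 * r ^ 2 * A (j + 2)) := by nlinarith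
        exact lt_of_mul_lt_mul_left this hX.le
      -- `A_{j+1}³ < 5r² A_{j+1}²A_{j+2} < 5r² A_0 < 5r² A_{j+1}`
      have h3 : A (j + 1) ^ 2 * A (j + 1) < A (j + 1) ^ 2 * (5 * r ^ 2 * A (j + 2)) := by
        nlinarith
      have h4 : A (j + 1) ^ 2 * (5 * r ^ 2 * A (j + 2)) < 5 * r ^ 2 * A (j + 1) := by nlinarith
      nlinarith
    · -- dissipation shell: `A_{j+1} < μ r^{j+2}` and `μ r^{j+1} A_{j+1} ≤ A_j² < 1`
      push Not at hcase
      have he := h.eq_succ j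
      have hj2 : A j ^ 2 < 1 := by
        have := h.flux_lt hμ hr0 j
        -- `A_j² A_{j+1} < A_0 < A_{j+1}`
        nlinarith
      have h5 : μ * r ^ (j + 1) * A (j + 1) < 1 := by nlinarith [mul_pos hX hZ]
      have h6 : A (j + 1) ^ 2 < r := by
        have : μ * r ^ (j + 2) * A (j + 1) < r := by
          have : μ * r ^ (j + 2) * A (j + 1) = r * (μ * r ^ (j + 1) * A (j + 1)) := by ring
          rw [this]; nlinarith
        nlinarith
      nlinarith

/-! ### Decay, and the energy identity for every `r > 1` -/

/-- Decay bound without monotonicity: `A_{j+1} < 5r²/(μr^{j+1})` (`μr^{j+1}A_{j+1} < A_j² < 5r²`).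
[cite: CheskidovFriedlander2009, Lemma 2.4 p.5–6 (proof) and Lemma 2.1 p.4] -/
theorem lt_div' (h : IsSteadyState μ r A) (hμ : 0 < μ) (hr : 1 ≤ r) (j : ℕ) :
    A (j + 1) < 5 * r ^ 2 / (μ * r ^ (j + 1)) := by
  have he := h.eq_succ j
  have h1 := h.pos (j + 1)
  have h2 := h.pos (j + 2)
  have hr0 : 0 < r := by linarith
  have hw : 0 < μ * r ^ (j + 1) := by positivity
  have hA := h.sq_lt_all hμ hr j
  rw [lt_div_iff₀ hw]
  nlinarith [mul_pos h1 h2]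

/-- `A_j → 0` for every steady state, `μ > 0`, `r > 1` (no monotonicity needed).
[cite: CheskidovFriedlander2009, Lemma 2.1 p.4 ("`A_j → 0` as `j → ∞`")] -/
theorem tendsto_zero' (h : IsSteadyState μ r A) (hμ : 0 < μ) (hr1 : 1 < r) :
    Tendsto A atTop (𝓝 0) := by
  have hr0 : 0 < r := by linarith
  have hg : Tendsto (fun j : ℕ => 5 * r ^ 2 / μ * (r⁻¹) ^ j) atTop (𝓝 0) := by
    have := tendsto_pow_atTop_nhds_zero_of_lt_one (inv_nonneg.2 hr0.le) (inv_lt_one_of_one_lt₀ hr1)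
    simpa using this.const_mul (5 * r ^ 2 / μ)
  have hshift : Tendsto (fun j : ℕ => A (j + 1)) atTop (𝓝 0) := by
    refine squeeze_zero (fun j => (h.pos (j + 1)).le) (fun j => ?_)
      ((hg.comp (tendsto_add_atTop_nat 1)))
    have := h.lt_div' hμ hr1.le j
    simp only [Function.comp_apply]
    rw [inv_pow, ← div_eq_mul_inv, div_div]
    exact this.le
  exact (tendsto_add_atTop_iff_nat 1).1 hshift

/-- **Energy identity for every `r > 1`:** `μ Σ_j r^j A_j² = A_0` — dissipation = injected power
(the tree's `hasSum_dissipation` asks `r < 2` only through the monotonicity).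
[cite: CheskidovFriedlander2009, Lemma 2.1 p.4 (proof, first display)] -/
theorem hasSum_dissipation' (h : IsSteadyState μ r A) (hμ : 0 < μ) (hr1 : 1 < r) :
    HasSum (fun j => μ * r ^ j * A j ^ 2) (A 0) := by
  have hr0 : 0 < r := by linarith
  refine (hasSum_iff_tendsto_nat_of_nonneg (fun j => ?_) _).2 ?_
  · have := h.pos j
    positivity
  have heq : (fun N : ℕ => ∑ j ∈ range N, μ * r ^ j * A j ^ 2) ∘ (fun N => N + 1) =
      fun N => A 0 - A N ^ 2 * A (N + 1) := by
    funext N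
    exact h.sum_dissipation_eq N
  have hlim : Tendsto (fun N : ℕ => A 0 - A N ^ 2 * A (N + 1)) atTop (𝓝 (A 0)) := by
    have h0 := h.tendsto_zero' hμ hr1
    have h1 : Tendsto (fun N : ℕ => A (N + 1)) atTop (𝓝 0) := h0.comp (tendsto_add_atTop_nat 1)
    have := (h0.pow 2).mul h1
    simpa using this.const_sub (A 0)
  rw [← heq] at hlim
  exact (tendsto_add_atTop_iff_nat 1).1 hlim

/-- **The steady-state zeroth law at every ratio:** `1/(8r) < μ Σ_j r^j A_j²` for every steady
state with `0 < μ ≤ 1`, `1 < r` — a dissipation floor independent of the viscosity, Kolmogorov's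
`r = 2^{4/3}` (`c = 1`) included. [cite: CheskidovFriedlander2009, Thm 4.2 p.9–10] -/
theorem dissipation_floor (h : IsSteadyState μ r A) (hμ : 0 < μ) (hμ1 : μ ≤ 1) (hr1 : 1 < r) :
    1 / (8 * r) < ∑' j, μ * r ^ j * A j ^ 2 := by
  rw [(h.hasSum_dissipation' hμ hr1).tsum_eq]
  exact h.inv_lt hμ hμ1 hr1.le

/-- And the matching ceiling `μ Σ_j r^j A_j² < 3r`, every `μ > 0`, `r > 1`.
[cite: CheskidovFriedlander2009, Lemma 2.3 p.5] -/
theorem dissipation_lt (h : IsSteadyState μ r A) (hμ : 0 < μ) (hr1 : 1 < r) :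
    ∑' j, μ * r ^ j * A j ^ 2 < 3 * r := by
  rw [(h.hasSum_dissipation' hμ hr1).tsum_eq]
  exact h.lt_three_mul hμ hr1.le

/-! ### Amplification of ratio deviations in the inertial range -/

/-- **Two-step amplification.** An up-deviation `A_{j+1} ≥ (1+η)A_j` (`η > 0`) at a shell where
the viscosity is still small relative to the deviation, `μr^{j+2} ≤ (η/2)A_{j+1}`, is followed by
`A_{j+2} ≤ A_{j+1}/(1+η)²` and then by the TRIPLED up-deviation `A_{j+3} ≥ (1+3η)A_{j+2}`, with a
higher top `A_{j+3} ≥ A_{j+1}` (the inviscid map squares ratios; the viscous loss costs at most a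
factor `(1+η)^{-1}`). This is the quantitative form of the step "`liminf A_j > 1` ⇒
`limsup A_{j+1} < 1` and `liminf A_{j+2} > 1`" in the printed proof of Lemma 2.3.
[cite: CheskidovFriedlander2009, Lemma 2.3 p.5 (proof)] -/
theorem amplify (h : IsSteadyState μ r A) (hμ : 0 ≤ μ) (hr : 0 ≤ r) {j : ℕ} {η : ℝ} (hη : 0 < η)
    (hup : (1 + η) * A j ≤ A (j + 1)) (hv : μ * r ^ (j + 2) ≤ η / 2 * A (j + 1)) :
    (1 + 3 * η) * A (j + 2) ≤ A (j + 3) ∧ A (j + 1) ≤ A (j + 3) := by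
  have ha := h.pos j
  have hT := h.pos (j + 1)
  have hB := h.pos (j + 2)
  have hW := h.pos (j + 3)
  -- `(1+η)² A_{j+2} ≤ A_{j+1}`
  have hu := h.mul_le_sq hμ hr j
  have hB2 : (1 + η) ^ 2 * A (j + 2) ≤ A (j + 1) := by
    have h1 : ((1 + η) * A j) ^ 2 ≤ A (j + 1) ^ 2 := pow_le_pow_left₀ (by positivity) hup 2
    have h2 : (1 + η) ^ 2 * (A (j + 1) * A (j + 2)) ≤ A (j + 1) * A (j + 1) := by nlinarith
    have h3 : A (j + 1) * ((1 + η) ^ 2 * A (j + 2)) ≤ A (j + 1) * A (j + 1) := by nlinarith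
    exact le_of_mul_le_mul_left h3 hT
  -- the equation at `j+1`: `A_{j+2}A_{j+3} = A_{j+1}² − μr^{j+2}A_{j+2} ≥ A_{j+1}² − (η/2)A_{j+1}A_{j+2}`
  have he : A (j + 1) ^ 2 - A (j + 2) * A (j + 3) = μ * r ^ (j + 2) * A (j + 2) := by
    have := h.eq_succ (j + 1)
    simpa [add_assoc] using this
  have hprod : A (j + 1) ^ 2 - η / 2 * A (j + 1) * A (j + 2) ≤ A (j + 2) * A (j + 3) := by
    nlinarith [mul_le_mul_of_nonneg_right hv hB.le]
  -- write `A_{j+1} = (1+η)²A_{j+2} + s`, `s ≥ 0`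
  have hs : 0 ≤ A (j + 1) - (1 + η) ^ 2 * A (j + 2) := sub_nonneg.2 hB2
  set s := A (j + 1) - (1 + η) ^ 2 * A (j + 2) with hsdef
  have hTs : A (j + 1) = (1 + η) ^ 2 * A (j + 2) + s := by rw [hsdef]; ring
  constructor
  · -- `A_{j+2}A_{j+3} ≥ (1+3η)A_{j+2}²`
    have key : (1 + 3 * η) * A (j + 2) ^ 2 ≤ A (j + 1) ^ 2 - η / 2 * A (j + 1) * A (j + 2) := by
      rw [hTs]
      have hpoly : 0 ≤ (1 + η) ^ 4 - η / 2 * (1 + η) ^ 2 - (1 + 3 * η) := by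
        have : (1 + η) ^ 4 - η / 2 * (1 + η) ^ 2 - (1 + 3 * η) =
            η / 2 + 5 * η ^ 2 + 7 / 2 * η ^ 3 + η ^ 4 := by ring
        rw [this]; positivity
      nlinarith [mul_nonneg hpoly (sq_nonneg (A (j + 2))), mul_nonneg hs hs,
        mul_nonneg hs hB.le, mul_nonneg (mul_nonneg hs hB.le) hη.le,
        mul_nonneg (mul_nonneg hs hB.le) (sq_nonneg η)]
    have : A (j + 2) * ((1 + 3 * η) * A (j + 2)) ≤ A (j + 2) * A (j + 3) := by nlinarith
    exact le_of_mul_le_mul_left this hB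
  · -- `A_{j+2}A_{j+3} ≥ A_{j+1}A_{j+2}`
    have key : A (j + 1) * A (j + 2) ≤ A (j + 1) ^ 2 - η / 2 * A (j + 1) * A (j + 2) := by
      -- `A_{j+1}(A_{j+1} − (1 + η/2)A_{j+2}) ≥ 0` since `A_{j+1} ≥ (1+η)²A_{j+2} ≥ (1+η/2)A_{j+2}`
      have h1 : (1 + η / 2) * A (j + 2) ≤ A (j + 1) := by
        nlinarith [mul_nonneg (by positivity : (0:ℝ) ≤ 3 / 2 * η + η ^ 2) hB.le]
      nlinarith [mul_nonneg hT.le (sub_nonneg.2 h1)]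
    have : A (j + 2) * A (j + 1) ≤ A (j + 2) * A (j + 3) := by nlinarith
    exact le_of_mul_le_mul_left this hB

/-- **Iterated amplification:** from an up-deviation `A_{j+1} ≥ (1+η)A_j`, as long as
`μr^{j+2k} ≤ (η/2)A_{j+1}`, the up-deviations at the shells `j+2i` (`i ≤ k`) are at least `3^iη`
and the tops `A_{j+2i+1}` do not decrease. [cite: CheskidovFriedlander2009, Lemma 2.3 p.5 (proof)] -/
theorem amplify_iter (h : IsSteadyState μ r A) (hμ : 0 ≤ μ) (hr : 1 ≤ r) {j : ℕ} {η : ℝ}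
    (hη : 0 < η) (hup : (1 + η) * A j ≤ A (j + 1)) (k : ℕ)
    (hv : μ * r ^ (j + 2 * k) ≤ η / 2 * A (j + 1)) :
    (1 + 3 ^ k * η) * A (j + 2 * k) ≤ A (j + 2 * k + 1) ∧ A (j + 1) ≤ A (j + 2 * k + 1) := by
  have hr0 : 0 ≤ r := by linarith
  induction k with
  | zero => exact ⟨by simpa using hup, by simp⟩
  | succ k ih =>
    have hv' : μ * r ^ (j + 2 * k) ≤ η / 2 * A (j + 1) := by
      have : μ * r ^ (j + 2 * k) ≤ μ * r ^ (j + 2 * (k + 1)) :=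
        mul_le_mul_of_nonneg_left (pow_le_pow_right₀ hr (by omega)) hμ
      exact this.trans hv
    obtain ⟨h1, h2⟩ := ih hv'
    have hηk : 0 < 3 ^ k * η := by positivity
    have h3k : (1 : ℝ) ≤ 3 ^ k := one_le_pow₀ (by norm_num)
    -- viscosity at the shell `j + 2k + 2` against the current deviation and top
    have hvk : μ * r ^ (j + 2 * k + 2) ≤ 3 ^ k * η / 2 * A (j + 2 * k + 1) := by
      have hT := h.pos (j + 1)
      calc μ * r ^ (j + 2 * k + 2) = μ * r ^ (j + 2 * (k + 1)) := by ring_nf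
        _ ≤ η / 2 * A (j + 1) := hv
        _ ≤ 3 ^ k * η / 2 * A (j + 2 * k + 1) := by
            have : η / 2 * A (j + 1) ≤ η / 2 * A (j + 2 * k + 1) := by gcongr
            have : η / 2 * A (j + 2 * k + 1) ≤ 3 ^ k * η / 2 * A (j + 2 * k + 1) := by
              have hA := h.pos (j + 2 * k + 1)
              have : η / 2 ≤ 3 ^ k * η / 2 := by nlinarith
              exact mul_le_mul_of_nonneg_right this hA.le
            linarith
    have hamp := h.amplify hμ hr0 hηk h1 hvk
    refine ⟨?_, ?_⟩
    · have e1 : j + 2 * (k + 1) = j + 2 * k + 2 := by ring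
      have e3 : (3 : ℝ) ^ (k + 1) * η = 3 * (3 ^ k * η) := by ring
      rw [e1, show j + 2 * k + 2 + 1 = j + 2 * k + 3 from rfl, e3]
      exact hamp.1
    · have e2 : j + 2 * (k + 1) + 1 = j + 2 * k + 3 := by ring
      rw [e2]
      exact h2.trans hamp.2

/-- **No up-deviation of size `η` in the inertial range.** If `3^kη ≥ 2r` (`0 < η ≤ 2`) and
`μr^{j+2k+2} ≤ (η/2)A_{j+1}`, then `A_{j+1} < (1+η)A_j`: otherwise after `k` amplifications the
deviation exceeds `2r` and the next downward step is a collapse (`sq_lt_mul`).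
[cite: CheskidovFriedlander2009, Lemma 2.3 p.5 and Thm 2.2 p.4–5] -/
theorem lt_of_up (h : IsSteadyState μ r A) (hμ : 0 ≤ μ) (hr : 1 ≤ r) {j : ℕ} {η : ℝ}
    (hη : 0 < η) (hη2 : η ≤ 2) {k : ℕ} (hk : 2 * r ≤ 3 ^ k * η)
    (hv : μ * r ^ (j + 2 * k + 2) ≤ η / 2 * A (j + 1)) : A (j + 1) < (1 + η) * A j := by
  by_contra hup
  push Not at hup
  have hr0 : 0 ≤ r := by linarith
  have hT1 := h.pos (j + 1)
  have hv' : μ * r ^ (j + 2 * k) ≤ η / 2 * A (j + 1) := by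
    have : μ * r ^ (j + 2 * k) ≤ μ * r ^ (j + 2 * k + 2) :=
      mul_le_mul_of_nonneg_left (pow_le_pow_right₀ hr (by omega)) hμ
    exact this.trans hv
  obtain ⟨h1, h2⟩ := h.amplify_iter hμ hr hη hup k hv'
  set m := j + 2 * k with hm
  have hX := h.pos m
  have hT := h.pos (m + 1)
  have hB := h.pos (m + 2)
  -- `(1 + 3^kη)² A_{m+2} ≤ A_{m+1}`
  have hu := h.mul_le_sq hμ hr0 m
  have hB2 : (1 + 3 ^ k * η) ^ 2 * A (m + 2) ≤ A (m + 1) := by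
    have hpos : 0 ≤ (1 + 3 ^ k * η) * A m := by positivity
    have e1 : ((1 + 3 ^ k * η) * A m) ^ 2 ≤ A (m + 1) ^ 2 := pow_le_pow_left₀ hpos h1 2
    have e3 : A (m + 1) * ((1 + 3 ^ k * η) ^ 2 * A (m + 2)) ≤ A (m + 1) * A (m + 1) := by
      nlinarith
    exact le_of_mul_le_mul_left e3 hT
  -- viscosity at `m+2` is below the top: `μ r^{m+2} ≤ (η/2) A_{j+1} ≤ A_{m+1}`
  have hvm : μ * r ^ (m + 2) ≤ A (m + 1) := by
    have : η / 2 * A (j + 1) ≤ A (m + 1) := by nlinarith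
    exact hv.trans this
  -- no collapse at `m+1`: `A_{m+1}² < A_{m+2}(4r²A_{m+1} + μr^{m+2}) ≤ (4r²+1)A_{m+1}A_{m+2}`
  have hnc := h.sq_lt_mul hμ hr (m + 1)
  have h3 : A (m + 1) ^ 2 < (4 * r ^ 2 + 1) * A (m + 1) * A (m + 2) := by
    have : A (m + 1 + 1) * (4 * r ^ 2 * A (m + 1) + μ * r ^ (m + 1 + 1)) ≤
        A (m + 2) * (4 * r ^ 2 * A (m + 1) + A (m + 1)) := by
      rw [show m + 1 + 1 = m + 2 from rfl]
      gcongr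
    nlinarith
  -- hence `(1+3^kη)² < 4r² + 1`, contradicting `3^kη ≥ 2r`
  have h4 : (1 + 3 ^ k * η) ^ 2 * A (m + 1) < (4 * r ^ 2 + 1) * A (m + 1) := by
    calc (1 + 3 ^ k * η) ^ 2 * A (m + 1) = (1 + 3 ^ k * η) ^ 2 * A (m + 1) := rfl
      _ < (4 * r ^ 2 + 1) * A (m + 1) := by nlinarith
  have h5 : (1 + 3 ^ k * η) ^ 2 < 4 * r ^ 2 + 1 := lt_of_mul_lt_mul_right h4 hT.le
  nlinarith

/-- **No down-deviation of size `η` in the inertial range.** If `3^kη ≥ 2r` (`0 < η ≤ 2`) and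
`μr^{j+2k+3} ≤ (η/2)A_{j+1}`, then `A_j < (1+η)A_{j+1}`: a downward step by `(1+η)^{-1}` is
followed by an upward step by at least `1+η` (the viscous loss is `≤ (η/2)A_{j+1}`), excluded by
`lt_of_up` at `j+1`. [cite: CheskidovFriedlander2009, Lemma 2.3 p.5 (proof)] -/
theorem lt_of_down (h : IsSteadyState μ r A) (hμ : 0 ≤ μ) (hr : 1 ≤ r) {j : ℕ} {η : ℝ}
    (hη : 0 < η) (hη2 : η ≤ 2) {k : ℕ} (hk : 2 * r ≤ 3 ^ k * η)
    (hv : μ * r ^ (j + 2 * k + 3) ≤ η / 2 * A (j + 1)) : A j < (1 + η) * A (j + 1) := by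
  by_contra hdown
  push Not at hdown
  have hr0 : 0 ≤ r := by linarith
  have ha := h.pos j
  have hT := h.pos (j + 1)
  have hB := h.pos (j + 2)
  -- the up-step at `j+1`: `A_{j+1}A_{j+2} = A_j² − μr^{j+1}A_{j+1} ≥ (1+η)²A_{j+1}² − (η/2)A_{j+1}²`
  have he := h.eq_succ j
  have hv1 : μ * r ^ (j + 1) ≤ η / 2 * A (j + 1) := by
    have : μ * r ^ (j + 1) ≤ μ * r ^ (j + 2 * k + 3) :=
      mul_le_mul_of_nonneg_left (pow_le_pow_right₀ hr (by omega)) hμ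
    exact this.trans hv
  have hup : (1 + η) * A (j + 1) ≤ A (j + 2) := by
    have e1 : ((1 + η) * A (j + 1)) ^ 2 ≤ A j ^ 2 := pow_le_pow_left₀ (by positivity) hdown 2
    have e0 : μ * r ^ (j + 1) * A (j + 1) ≤ η / 2 * A (j + 1) * A (j + 1) :=
      mul_le_mul_of_nonneg_right hv1 hT.le
    have e3 : A (j + 1) * A (j + 2) = A j ^ 2 - μ * r ^ (j + 1) * A (j + 1) := by linarith
    have e2 : A (j + 1) * ((1 + η) * A (j + 1)) ≤ A (j + 1) * A (j + 2) := by
      rw [e3]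
      nlinarith [mul_pos hη (pow_pos hT 2), mul_pos (mul_pos hη hη) (pow_pos hT 2), pow_pos hT 2]
    exact le_of_mul_le_mul_left e2 hT
  -- and `lt_of_up` at `j+1`
  have hv2 : μ * r ^ (j + 1 + 2 * k + 2) ≤ η / 2 * A (j + 1 + 1) := by
    rw [show j + 1 + 2 * k + 2 = j + 2 * k + 3 by ring, show j + 1 + 1 = j + 2 from rfl]
    have : η / 2 * A (j + 1) ≤ η / 2 * A (j + 2) := by
      have : A (j + 1) ≤ A (j + 2) := by nlinarith
      gcongr
    exact hv.trans this
  have := h.lt_of_up hμ hr hη hη2 hk hv2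
  rw [show j + 1 + 1 = j + 2 from rfl] at this
  linarith

/-! ### Lemma 2.3 for every ratio: `A_0 → 1` as `μ → 0` -/

/-- A lower bound for `A_1`, uniform in small viscosity: `A_1 > 1/(6r)` for `μ ≤ 1/(6r)`
(`A_0A_1 = 1 − μA_0 > 1/2` and `A_0 < 3r`). [cite: CheskidovFriedlander2009, §2 (2.3) p.5] -/
theorem A_one_gt (h : IsSteadyState μ r A) (hμ : 0 < μ) (hr : 1 ≤ r) (hμr : μ ≤ 1 / (6 * r)) :
    1 / (6 * r) < A 1 := by
  have ha := h.pos 0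
  have hB := h.pos 1
  have hr0 : 0 < r := by linarith
  have h3 := h.lt_three_mul hμ hr
  have he0 := h.eq_zero
  have hμa : μ * A 0 < 1 / 2 := by
    calc μ * A 0 ≤ 1 / (6 * r) * A 0 := by gcongr
      _ < 1 / (6 * r) * (3 * r) := by gcongr
      _ = 1 / 2 := by field_simp; ring
  rw [div_lt_iff₀ (by positivity)]
  nlinarith

/-- **Lemma 2.3 (`j = 0`) for every ratio `r ≥ 1`, uniformly over all steady states:** for every
`δ > 0` there is `μ₁ > 0` such that `|A_0 − 1| < δ` for every steady state with `0 < μ ≤ μ₁`.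
Printed for `3/2 < c ≤ 5/2` via monotonicity; here from the ratio pinching `lt_of_up`/`lt_of_down`
at the forced shell and `A_0A_1 = 1 − μA_0`. With `hasSum_dissipation'`: the steady dissipation
`μΣ_j r^jA_j² = A_0 → 1`, i.e. `ν‖α^ν‖²_{H¹} → ε_d`, for every `0 < c < 3`.
[cite: CheskidovFriedlander2009, Lemma 2.3 p.5 and Thm 4.2 p.9–10] -/
theorem abs_A_zero_sub_one_lt {r : ℝ} (hr : 1 ≤ r) {δ : ℝ} (hδ : 0 < δ) :
    ∃ μ₁ : ℝ, 0 < μ₁ ∧ ∀ ⦃μ : ℝ⦄ ⦃A : ℕ → ℝ⦄, 0 < μ → μ ≤ μ₁ → IsSteadyState μ r A →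
      |A 0 - 1| < δ := by
  have hr0 : 0 < r := by linarith
  -- deviation size `η = min δ 1 / 2 ∈ (0, 1/2]`, number of amplifications `k` with `3^k η > 2r`
  set η : ℝ := min δ 1 / 2 with hηdef
  have hη : 0 < η := by positivity
  have hη1 : η ≤ 1 / 2 := by
    have : min δ 1 ≤ 1 := min_le_right _ _
    rw [hηdef]; linarith
  have hηδ : 2 * η ≤ δ := by
    have : min δ 1 ≤ δ := min_le_left _ _
    rw [hηdef]; linarith
  obtain ⟨k, hk⟩ := pow_unbounded_of_one_lt (2 * r / η) (by norm_num : (1 : ℝ) < 3)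
  have hk' : 2 * r ≤ 3 ^ k * η := by
    rw [div_lt_iff₀ hη] at hk; linarith
  -- the viscosity threshold
  set L : ℝ := 1 / (6 * r) with hL
  have hL0 : 0 < L := by positivity
  refine ⟨min (η / (6 * r)) (η / 2 * L / r ^ (2 * k + 3)), by positivity, ?_⟩
  intro μ A hμ hμ1 h
  have hμa : μ ≤ η / (6 * r) := hμ1.trans (min_le_left _ _)
  have hμb : μ ≤ η / 2 * L / r ^ (2 * k + 3) := hμ1.trans (min_le_right _ _)
  have hμL : μ ≤ 1 / (6 * r) := by
    calc μ ≤ η / (6 * r) := hμa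
      _ ≤ 1 / (6 * r) := by gcongr; linarith
  have ha := h.pos 0
  have hB := h.pos 1
  have he0 := h.eq_zero
  have hA1 := h.A_one_gt hμ hr hμL
  have h3r := h.lt_three_mul hμ hr
  -- the viscosity hypotheses of the pinching lemmas at `j = 0`
  have hrk : 0 < r ^ (2 * k + 3) := by positivity
  have hv3 : μ * r ^ (0 + 2 * k + 3) ≤ η / 2 * A (0 + 1) := by
    rw [zero_add, zero_add]
    have : μ * r ^ (2 * k + 3) ≤ η / 2 * L := by rwa [le_div_iff₀ hrk] at hμb
    calc μ * r ^ (2 * k + 3) ≤ η / 2 * L := this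
      _ ≤ η / 2 * A 1 := by rw [hL]; gcongr
  have hv2 : μ * r ^ (0 + 2 * k + 2) ≤ η / 2 * A (0 + 1) := by
    have : μ * r ^ (0 + 2 * k + 2) ≤ μ * r ^ (0 + 2 * k + 3) :=
      mul_le_mul_of_nonneg_left (pow_le_pow_right₀ hr (by omega)) hμ.le
    exact this.trans hv3
  have hup := h.lt_of_up hμ.le hr hη (by linarith) hk' hv2
  have hdown := h.lt_of_down hμ.le hr hη (by linarith) hk' hv3
  rw [zero_add] at hup hdown
  -- `A_0A_1 = 1 − μA_0` with `A_1/A_0 ∈ ((1+η)⁻¹, 1+η)` and `μA_0 ≤ η/2`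
  have hμA : μ * A 0 ≤ η / 2 := by
    calc μ * A 0 ≤ η / (6 * r) * (3 * r) := by gcongr
      _ = η / 2 := by field_simp; ring
  rw [abs_sub_lt_iff]
  constructor
  · -- `A_0 < 1 + η`: `A_0² < (1+η)A_0A_1 = (1+η)(1 − μA_0) < (1+η) ≤ (1+η)²`
    have h1 : A 0 ^ 2 < (1 + η) ^ 2 := by nlinarith [mul_pos hμ ha]
    have h2 : A 0 < 1 + η := by
      by_contra hle; push Not at hle
      have := pow_le_pow_left₀ (by positivity) hle 2
      linarith
    linarith
  · -- `A_0 > 1 − 2η`: `(1+η)A_0² > A_0A_1 = 1 − μA_0 ≥ 1 − η/2`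
    have h1 : 1 - η / 2 < (1 + η) * A 0 ^ 2 := by nlinarith
    have h2 : 1 - 2 * η < A 0 ^ 2 := by nlinarith
    by_cases ha1 : 1 ≤ A 0
    · linarith
    · push Not at ha1
      have : A 0 ^ 2 < A 0 := by nlinarith
      linarith

end IsSteadyState

/-! ### The original variables: every `0 < c < 3`, fixed force `f₀e₀`, all `ν > 0` -/

variable {c ν f₀ : ℝ} {α : ℕ → ℝ}

/-- `r = 2^{2 − 2c/3} < 4` iff `0 < c`. [cite: CheskidovFriedlander2009, §2 p.4] -/
theorem r_lt_four (hc : 0 < c) : (2 : ℝ) ^ (2 - 2 * c / 3) < 4 :=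
  calc (2 : ℝ) ^ (2 - 2 * c / 3) < (2 : ℝ) ^ (2 : ℝ) :=
        Real.rpow_lt_rpow_of_exponent_lt (by norm_num) (by linarith)
    _ = 4 := by norm_num

/-- **Termwise bound for every viscosity and every `0 < c < 3`:** a non-negative `ℓ²` fixed point
satisfies `α_j² < 80(α⁰_j)²` for all `j` (`A_j² < 5r² < 80`; at `3/2 < c` the printed bound is
`α_j < (4/3)α⁰_j`). [cite: CheskidovFriedlander2009, Thm 2.2 p.4 and Lemma 2.3 p.5] -/
theorem IsFixedPoint.sq_lt_inviscidFixedPoint_sq (hα : IsFixedPoint c ν (force f₀) α)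
    (hc : 0 < c) (hc3 : c < 3) (hν : 0 < ν) (hf : 0 < f₀) (hnn : ∀ j, 0 ≤ α j) (j : ℕ) :
    α j ^ 2 < 80 * inviscidFixedPoint c f₀ j ^ 2 := by
  have hst := hα.isSteadyState hc3.le hν hf hnn
  have hA := hst.sq_lt_all (mu_pos hν hf) (one_lt_r hc3).le j
  have hr4 := r_lt_four hc
  have hr0 : 0 < (2 : ℝ) ^ (2 - 2 * c / 3) := Real.rpow_pos_of_pos two_pos _
  have hκ := inviscidFixedPoint_pos c hf j
  have h80 : (α j / inviscidFixedPoint c f₀ j) ^ 2 < 80 := by nlinarith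
  rw [div_pow, div_lt_iff₀ (pow_pos hκ 2)] at h80
  exact h80

/-- **Uniform energy bound, every `ν > 0`, every `0 < c < 3`:** `|α^ν|² ≤ 80|α⁰|²`.
[cite: CheskidovFriedlander2009, Thm 2.2 p.4 and Lemma 2.3 p.5] -/
theorem IsFixedPoint.normSq_le_of_lt_three (hα : IsFixedPoint c ν (force f₀) α) (hc : 0 < c)
    (hc3 : c < 3) (hν : 0 < ν) (hf : 0 < f₀) (hnn : ∀ j, 0 ≤ α j) :
    normSq α ≤ 80 * normSq (inviscidFixedPoint c f₀) := by
  unfold normSq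
  rw [← tsum_mul_left]
  refine hα.1.tsum_le_tsum (fun j => ?_) ((summable_inviscidFixedPoint_sq hc hf.le).mul_left _)
  exact (hα.sq_lt_inviscidFixedPoint_sq hc hc3 hν hf hnn j).le

/-- **Dissipation floor, uniform in the viscosity, every `0 < c < 3`:** for `ν ≤ 2^{−c/6}√f₀`
(`μ ≤ 1`) every non-negative `ℓ²` fixed point has `ε_d/32 < f₀α₀ = ν‖α‖²_{H¹}` (`A_0 > 1/(8r) >
1/32`). [cite: CheskidovFriedlander2009, Thm 4.2 p.9–10] -/
theorem IsFixedPoint.epsilonD_div_lt (hα : IsFixedPoint c ν (force f₀) α) (hc : 0 < c)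
    (hc3 : c < 3) (hν : 0 < ν) (hf : 0 < f₀) (hnn : ∀ j, 0 ≤ α j)
    (hμ1 : ν * (2 : ℝ) ^ (c / 6) / Real.sqrt f₀ ≤ 1) : epsilonD c f₀ / 32 < f₀ * α 0 := by
  have hst := hα.isSteadyState hc3.le hν hf hnn
  have hA := hst.inv_lt (mu_pos hν hf) hμ1 (one_lt_r hc3).le
  have hr4 := r_lt_four hc
  have hr0 : 0 < (2 : ℝ) ^ (2 - 2 * c / 3) := Real.rpow_pos_of_pos two_pos _
  have hκ := inviscidFixedPoint_pos c hf 0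
  have h32 : (1 : ℝ) / 32 < 1 / (8 * (2 : ℝ) ^ (2 - 2 * c / 3)) := by
    rw [lt_div_iff₀ (by positivity)]
    have : 8 * (2 : ℝ) ^ (2 - 2 * c / 3) < 32 := by linarith
    calc (1 : ℝ) / 32 * (8 * (2 : ℝ) ^ (2 - 2 * c / 3)) < 1 / 32 * 32 := by gcongr
      _ = 1 := by norm_num
  have hA' : 1 / 32 < α 0 / inviscidFixedPoint c f₀ 0 := h32.trans hA
  rw [lt_div_iff₀ hκ] at hA'
  unfold epsilonD
  nlinarith

/-- The floor for the `H¹` dissipation itself: `ε_d/32 < νΣ_j 2^{2j}α_j²`.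
[cite: CheskidovFriedlander2009, Thm 4.2 p.9–10] -/
theorem IsFixedPoint.epsilonD_div_lt_dissipation (hα : IsFixedPoint c ν (force f₀) α)
    (hc : 0 < c) (hc3 : c < 3) (hν : 0 < ν) (hf : 0 < f₀) (hnn : ∀ j, 0 ≤ α j)
    (hμ1 : ν * (2 : ℝ) ^ (c / 6) / Real.sqrt f₀ ≤ 1) :
    epsilonD c f₀ / 32 < ν * ∑' j, (2 : ℝ) ^ (2 * j) * α j ^ 2 := by
  rw [hα.energy_eq hc3.le hν hnn]
  exact hα.epsilonD_div_lt hc hc3 hν hf hnn hμ1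

/-- **Lemma 2.3 / the last step of Thm. 4.2 for every `0 < c < 3`:** along ANY family
`ν ↦ α^ν` of non-negative `ℓ²` fixed points, `(α^ν,f) = f₀α^ν₀ → ε_d` as `ν → 0⁺`
(from `IsSteadyState.abs_A_zero_sub_one_lt`; printed for `3/2 < c ≤ 5/2`).
[cite: CheskidovFriedlander2009, Lemma 2.3 p.5 and Thm 4.2 p.10 (proof)] -/
theorem tendsto_epsilon_of_fixedPoints' (hc3 : c < 3) (hf : 0 < f₀)
    {α : ℝ → ℕ → ℝ} (hα : ∀ ν, 0 < ν → IsFixedPoint c ν (force f₀) (α ν) ∧ ∀ j, 0 ≤ α ν j) :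
    Tendsto (fun ν => f₀ * α ν 0) (𝓝[>] 0) (𝓝 (epsilonD c f₀)) := by
  have hεd := epsilonD_pos c hf
  have h26 : 0 < (2 : ℝ) ^ (c / 6) := Real.rpow_pos_of_pos two_pos _
  have hs : 0 < Real.sqrt f₀ := Real.sqrt_pos.mpr hf
  have hκ := inviscidFixedPoint_pos c hf 0
  have hr1 := (one_lt_r hc3).le
  rw [Metric.tendsto_nhdsWithin_nhds]
  intro ε hε
  obtain ⟨μ₁, hμ₁, hpin⟩ := IsSteadyState.abs_A_zero_sub_one_lt hr1 (div_pos hε hεd)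
  refine ⟨μ₁ * Real.sqrt f₀ / (2 : ℝ) ^ (c / 6), by positivity, fun ν hν hνd => ?_⟩
  have hν : 0 < ν := hν
  rw [Real.dist_eq, sub_zero, abs_of_pos hν] at hνd
  have hμle : ν * (2 : ℝ) ^ (c / 6) / Real.sqrt f₀ ≤ μ₁ := by
    rw [div_le_iff₀ hs]
    rw [lt_div_iff₀ h26] at hνd
    linarith
  have hst := (hα ν hν).1.isSteadyState hc3.le hν hf (hα ν hν).2
  have hA := hpin (mu_pos hν hf) hμle hst
  -- `f₀α₀ − ε_d = ε_d (A_0 − 1)`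
  have heq : f₀ * α ν 0 - epsilonD c f₀ =
      epsilonD c f₀ * (α ν 0 / inviscidFixedPoint c f₀ 0 - 1) := by
    unfold epsilonD
    field_simp
  rw [Real.dist_eq, heq, abs_mul, abs_of_pos hεd]
  calc epsilonD c f₀ * |α ν 0 / inviscidFixedPoint c f₀ 0 - 1|
      < epsilonD c f₀ * (ε / epsilonD c f₀) := by gcongr
    _ = ε := by field_simp

/-- **The steady-state zeroth law of the viscous dyadic model for EVERY `0 < c < 3`** (so for the
whole range `c ∈ [1, 5/2]` of op. cit. §5, Kolmogorov's `c = 1` included), in the shape of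
`steadyState_zerothLaw` (which needs `3/2 < c`): a family `ν ↦ α^ν` (`ν > 0`) of positive `ℓ²`
steady states with the same force `f₀e₀`, energy `|α^ν|² ≤ 80|α⁰|²` uniformly in `ν`, energy
equality = mean dissipation `ν‖α^ν‖²_{H¹} = f₀α^ν₀`, floor `> ε_d/32` for `ν ≤ 2^{−c/6}√f₀`, and
the exact limit `ν‖α^ν‖²_{H¹} → ε_d = 2^{c/6}f₀^{3/2} > 0` as `ν → 0⁺`.
[cite: CheskidovFriedlander2009, Thm 4.2 pp.9–10, Lemma 2.3 p.5, §5 p.8] -/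
theorem steadyState_zerothLaw_of_lt_three (hc : 0 < c) (hc3 : c < 3) (hf : 0 < f₀) :
    ∃ α : ℝ → ℕ → ℝ,
      (∀ ν, 0 < ν → IsFixedPoint c ν (force f₀) (α ν) ∧ (∀ j, 0 < α ν j) ∧
        IsSolution c ν (force f₀) (fun j _ => α ν j)) ∧
      (∀ ν, 0 < ν → normSq (α ν) ≤ 80 * normSq (inviscidFixedPoint c f₀)) ∧
      (∀ ν, 0 < ν → ν * ∑' j, (2 : ℝ) ^ (2 * j) * α ν j ^ 2 = f₀ * α ν 0) ∧
      (∀ ν, 0 < ν → ∀ T, 0 < T → meanDissipation ν (fun j _ => α ν j) T = f₀ * α ν 0) ∧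
      (∀ ν, 0 < ν → ν * (2 : ℝ) ^ (c / 6) / Real.sqrt f₀ ≤ 1 →
        epsilonD c f₀ / 32 < ν * ∑' j, (2 : ℝ) ^ (2 * j) * α ν j ^ 2) ∧
      Tendsto (fun ν => ν * ∑' j, (2 : ℝ) ^ (2 * j) * α ν j ^ 2) (𝓝[>] 0)
        (𝓝 (epsilonD c f₀)) ∧
      0 < epsilonD c f₀ := by
  have hex : ∀ ν : ℝ, 0 < ν → ∃ α : ℕ → ℝ, IsFixedPoint c ν (force f₀) α ∧ ∀ j, 0 ≤ α j :=
    fun ν hν =>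
      let ⟨α, hα, hnn, _⟩ := exists_isFixedPoint c hν hf
      ⟨α, hα, hnn⟩
  choose! α hα hnn using hex
  have henergy : ∀ ν, 0 < ν → ν * ∑' j, (2 : ℝ) ^ (2 * j) * α ν j ^ 2 = f₀ * α ν 0 :=
    fun ν hν => (hα ν hν).energy_eq hc3.le hν (hnn ν hν)
  refine ⟨α, fun ν hν => ⟨hα ν hν, (hα ν hν).pos hf (hnn ν hν), (hα ν hν).isSolution⟩,
    fun ν hν => (hα ν hν).normSq_le_of_lt_three hc hc3 hν hf (hnn ν hν), henergy,
    fun ν hν T hT => (hα ν hν).meanDissipation_eq hc3.le hν (hnn ν hν) hT,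
    fun ν hν hμ1 => (hα ν hν).epsilonD_div_lt_dissipation hc hc3 hν hf (hnn ν hν) hμ1, ?_,
    epsilonD_pos c hf⟩
  have hlim := tendsto_epsilon_of_fixedPoints' hc3 hf fun ν hν => ⟨hα ν hν, hnn ν hν⟩
  refine hlim.congr' ?_
  filter_upwards [self_mem_nhdsWithin] with ν hν
  exact (henergy ν hν).symm

/-- **Corollary (the anomalous-dissipation shape) for every `0 < c < 3`:** `E, ε, ν₀ > 0` and
steady states `α^ν` (`ν > 0`) with force `f₀e₀`, `|α^ν|² ≤ E` for all `ν > 0` and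
`ν‖α^ν‖²_{H¹} ≥ ε` for `ν ∈ (0, ν₀]`. [cite: CheskidovFriedlander2009, Thm 4.2 pp.9–10] -/
theorem exists_steadyStates_dissipation_floor_of_lt_three (hc : 0 < c) (hc3 : c < 3)
    (hf : 0 < f₀) :
    ∃ E ε ν₀ : ℝ, 0 < E ∧ 0 < ε ∧ 0 < ν₀ ∧ ∃ α : ℝ → ℕ → ℝ,
      (∀ ν, 0 < ν → IsFixedPoint c ν (force f₀) (α ν) ∧ (∀ j, 0 < α ν j)) ∧
      (∀ ν, 0 < ν → normSq (α ν) ≤ E) ∧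
      (∀ ν, 0 < ν → ν ≤ ν₀ → ε ≤ ν * ∑' j, (2 : ℝ) ^ (2 * j) * α ν j ^ 2) := by
  obtain ⟨α, hsol, hE, -, -, hfloor, -, hεd⟩ := steadyState_zerothLaw_of_lt_three hc hc3 hf
  have h26 : 0 < (2 : ℝ) ^ (c / 6) := Real.rpow_pos_of_pos two_pos _
  have hs : 0 < Real.sqrt f₀ := Real.sqrt_pos.mpr hf
  have hE0 : 0 < (80 : ℝ) * normSq (inviscidFixedPoint c f₀) := by
    have : 0 < normSq (inviscidFixedPoint c f₀) := by
      unfold normSq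
      exact (summable_inviscidFixedPoint_sq hc hf.le).tsum_pos
        (fun j => sq_nonneg _) 0 (pow_pos (inviscidFixedPoint_pos c hf 0) 2)
    positivity
  refine ⟨80 * normSq (inviscidFixedPoint c f₀), epsilonD c f₀ / 32,
    Real.sqrt f₀ / (2 : ℝ) ^ (c / 6), hE0, by positivity, by positivity, α,
    fun ν hν => ⟨(hsol ν hν).1, (hsol ν hν).2.1⟩, hE, fun ν hν hν₀ => ?_⟩
  have hμ1 : ν * (2 : ℝ) ^ (c / 6) / Real.sqrt f₀ ≤ 1 := by
    rw [div_le_iff₀ hs, one_mul]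
    rwa [le_div_iff₀ h26] at hν₀
  exact (hfloor ν hν hμ1).le

end Literature.Analysis.FluidPDE.CheskidovFriedlander2009

end
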